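import Literature.IUT.HodgeArakelov.StableCurveAgreementPiDictionary
import Literature.IUT.HodgeArakelov.StableCurveAgreementOfSpecialFibre
import Literature.IUT.HodgeArakelov.LabelClassesOfCuspsCor24iOfSpecialFibre
import Literature.IUT.HodgeArakelov.PlusMinusTowerPiVNormal
import Literature.IUT.HodgeArakelov.PlusMinusTowerPiVIndex
import HarnessLib

/-!
# [IUTchII] Def 2.3 (i): the Π-level `ℍ`-dictionary AT THE GENUINE AGREEMENT `ofPiCHat ↔ ofSpecialFibre` (B15) — «`Π^±_{v▶} = Π^tp_{X̲_v,ℍ}`»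

S. Mochizuki, *Inter-universal Teichmüller Theory II*, kurims manuscript (Dec. 2020), §2, Def 2.3 (i) p. 67 («`Π^±_v := Π^tp_{X_v}`,
`Π̂^±_v := Π̂_{X_v}`», «`Π^±_{v▶} := N_{Π^±_v}(Π_{v▶})` … `Π^±_{v▶} ∩ Π_v = Π_{v▶}` [cf. [IUTchI], Corollary 2.3, (iv)]»); *Inter-universal
Teichmüller Theory I* (May 2020), §2, Cor 2.3 (iii)(iv) p. 47; [SemiAnbd] §6 p. 69 (uniqueness of the profinite completion)
[cite: Mochizuki2012, II Def 2.3 (i) p.67; I Cor 2.3 (iii)(iv) p.47] [cite: MochizukiSemiAnbd2006, §6 p.69] (D-0012 claim key, status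
disputed; every printed statement of the series is a HYPOTHESIS named by the tree's declarations — nothing of the series is asserted).
abc-iut cell, seat abc-iut-w5-d132 (gen 5), row «NV-L6 PiSubgraphDictionary-GENUINE», GENUINE half (generic half:
`StableCurveAgreementPiDictionary`, this seat).  PROOF-ONLY (no `def`, no `structure`, no `instance`); consumes BY NAME this lineage's
p430970 construction through abc-iut-w4-d012's bicontinuity-recording re-run `exists_of_isProfiniteCompletion_isHomeomorph` (p437194), p431233 (`exists_embHat_ofPiCHat`, `continuous_aug_pmHat_ofPiCHat`),
p430433 (`ofCoverModel_aug_ι_inclX`), abc-iut-L6-t19's B14 `PlusMinusTower.ofPiCHat` / `TemperedCoverings.plainIso`, abc-iut-L6-t7's B15 piece 1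
`TemperedCurve.ofOpenSubgroup`, abc-iut-L5's `StableCurveTemperedData.ofSpecialFibre`, abc-iut-L6-t19's `range_incl_normal` /
`index_range_incl`, abc-iut-L2-t8's `ofUnderline_range_inclPlain` / `ofUnderline_index_eq`.

* `StableCurveAgreement.exists_piSubgraphDictionary_of_isProfiniteCompletion` — the B15 core with bicontinuous `eHat` (abc-iut-w4-d012's
  `exists_of_isProfiniteCompletion_isHomeomorph`, p437194 = this lineage's p430970 re-run exposing `IsHomeomorph A.eHat`) PLUS the dictionary
  `A.PiSubgraphDictionary H▶` from `piSubgraphDictionary_comap` (p437206);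
* **`PlusMinusTower.exists_stableCurveAgreement_piSubgraphDictionary_ofPiCHat_ofSpecialFibre`** — at abc-iut-L6-t19's GENUINE tower `ofPiCHat`
  and abc-iut-L5's GENUINE [IUTchI] §2 datum `ofSpecialFibre` of `X̲_v` (exactly the setting of p433029): an agreement `A` with `eHat ∘ emb =
  ιX ∘ plainIso`, `eHat` BICONTINUOUS, and — given [IUTchI] Cor 2.3 (iv) for that datum (`Cor23iv` under `Cor23Hyp`, BY NAME, FACT policy) —
  **`A.PiSubgraphDictionary H▶`** for the decomposition subgroup `H▶ := incl⁻¹(plainIso⁻¹ Π^tp_{X̲_v,ℍ})` («`Π_{v▶} := Π_v ∩ Π^tp_{X̲_v,ℍ}`»):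
  `Π_v ⊴ Π^±_v` (the tower's own input `hN`) of index `l ≠ 0` (abc-iut-L2-t8) are THEOREMS there.

HONEST LABEL: GENUINE on both sides modulo the binders named in the signature (`hZ`, `hN`, `hDopen`, the special-fibre DATA of `X̲_v`,
[IUTchI] Cor 2.3 (iv) for that datum); `H▶` is the decomposition subgroup of `ℍ` CUT OUT BY THE DATUM — its identification with abc-iut-L6-t1's
`SubgraphDecomposition.Ptri` is the MERGE identification (plan/L6/MERGE-MAP.md), NOT claimed.  The Prop-package `PiSubgraphDictionary`
(0 dischargers in abc-iut-w5-d114's census v6b) thereby has a discharger at a genuine instance.  Nothing of the series is asserted;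
witnessed ≠ endorsed; no side taken on [IUTchIII] Cor 3.12.
-/

noncomputable section

namespace Literature.IUT.HodgeArakelov

open Literature.AnabelianGeometry.EtaleTheta Literature.AnabelianGeometry.SemiGraphs Literature.IUT.HodgeTheaters
open scoped Pointwise

universe u

namespace PlusMinusTower

namespace StableCurveAgreement

variable {S : BadPlaceSetting.{u}} {P : TopGroup.{u}} {T : TemperedCoverings S P}

/-- **[IUTchII] Def 2.3 (i) — the Π-level `ℍ`-dictionary from a common profinite completion.**  In the setting of
`exists_of_isProfiniteCompletion_isHomeomorph` with `embHat = emb` (corestricted), `Π_v ⊴ Π^±_v` of finite index and [IUTchI] Cor 2.3 (iv)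
for `D` (`Cor23iv` under `Cor23Hyp`, BY NAME): the agreement `A` moreover satisfies `A.PiSubgraphDictionary H▶` for
`H▶ := incl⁻¹(φ⁻¹ Π^tp_{X,ℍ})`.  PROVED (abc-iut-w4-d012's `exists_of_isProfiniteCompletion_isHomeomorph` — the p430970 core with the
bicontinuity of `eHat` exposed, p437194 — composed with `piSubgraphDictionary_comap`). ([IUTchII] Def 2.3 (i), kurims p.67) [claim: Mochizuki2012, status: disputed] -/
theorem exists_piSubgraphDictionary_of_isProfiniteCompletion (W : PlusMinusTower T) (D : StableCurveTemperedData.{u})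
    (embHat : T.Xplain →ₜ* W.pmHat) (hembHat : ∀ x, ((embHat x : W.pmHat) : W.Corhat) = W.emb x)
    (hW : IsProfiniteCompletion embHat)
    (ιXHat : D.PiTp →ₜ* D.PiHat) (hιXHat : ∀ y, ιXHat y = D.ιX y) (hD : IsProfiniteCompletion ιXHat)
    (φ : T.Xplain ≃ₜ* D.PiTp)
    (haug : Continuous (W.aug.comp W.pmHat.subtype)) [T2Space D.Gk] (hpr : Continuous D.prHat)
    (σ : S.Gk →* D.Gk) (hσc : Continuous σ) (hσ : Function.Injective σ)
    (hcompat : ∀ x : T.Xplain, D.prTp (φ x) = σ (W.aug (W.emb x)))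
    (hN : T.incl.range.Normal) (hI : T.incl.range.index ≠ 0) (hHyp : D.Cor23Hyp) (h23iv : D.Cor23iv) :
    ∃ Cu : CuspidalInertiaData W, ∃ A : StableCurveAgreement W Cu D,
      IsHomeomorph A.eHat ∧
      (∀ x : T.Xplain, A.eHat (embHat x) = D.ιX (φ x)) ∧
      (∀ (Q I : Subgroup W.Corhat), Cu.IsCuspidalInertia Q I ↔
        I ≤ Q ∧ ∃ I₀ : Subgroup W.Corhat, Cu.IsCuspidalInertia W.piPM I₀ ∧ I = I₀ ⊓ Q) ∧
      A.PiSubgraphDictionary ((D.piTpXH.comap φ.toMulEquiv.toMonoidHom).comap T.incl) := by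
  obtain ⟨Cu, A, hhom, hA, hlev⟩ := exists_of_isProfiniteCompletion_isHomeomorph W D embHat hembHat hW ιXHat
    hιXHat hD φ haug hpr σ hσc hσ hcompat
  have hA' : ∀ x : T.Xplain, A.eHat ⟨W.emb x, W.emb_le_pmHat ⟨x, rfl⟩⟩ = D.ιX (φ.toMulEquiv x) := by
    intro x
    have h2 : embHat x = ⟨W.emb x, W.emb_le_pmHat ⟨x, rfl⟩⟩ := Subtype.ext (hembHat x)
    rw [← h2]; exact hA x
  exact ⟨Cu, A, hhom, hA, hlev, A.piSubgraphDictionary_comap hhom φ.toMulEquiv hA' hN hI hHyp h23iv⟩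

end StableCurveAgreement

/-! ### The genuine instance: `ofPiCHat ↔ ofSpecialFibre` (the setting of p433029) -/

section Genuine

variable {p : ℕ} [Fact p.Prime] {M : MuTwoSetting p} (e : M.CLevelData)
  {E : M.toThetaSetting.EtaleThetaData} {l : ℕ} (C : E.DoubleUnderline l) {N : ℕ+}
  (μ : M.toThetaSetting.CyclotomeMod l N) (hC : M.toThetaSetting.Compat) (hS : M.toThetaSetting.Sec2Hyps)
  (hl : l.Prime) (hp2 : p ≠ 2) (hpl : p ≠ l) (hζ : ∃ ζ : M.toThetaSetting.K, IsPrimitiveRoot ζ (4 * l))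
  {η : (C.thetaEnvData μ hC hS).PiYdd → MuN p N} (hη : η ∈ (C.thetaEnvData μ hC hS).thetaCocycles)
  (hZ : Thm16Sub.KerToZIsCompactlyGenerated M.toThetaSetting) (hN : (C.Huu.subgroupOf (M.GtpXu l)).Normal)
  {P : TopGroup.{0}} (T : TemperedCoverings (BadPlaceSetting.ofUnderline C μ hC hS hl hp2 hpl hζ hη) P)

include hN in
/-- **`Π_v ⊴ Π^±_v` IN `Π^tp_{X̲_v}(P)`** over the print-level setting `BadPlaceSetting.ofUnderline` (p420095): the arithmetic normality `hN`
(`Π^tp_X̲̲ ⊴ Π^tp_X̲`) gives `incl(P) ⊴ Π^tp_{X̲_v}(P)` for every Prop. 2.1 output `T` (abc-iut-L6-t19 `range_incl_normal`, abc-iut-L2-t8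
`ofUnderline_range_inclPlain`).  PROVED. ([IUTchII] Def 2.3 (i), kurims p.67) [claim: Mochizuki2012, status: disputed] -/
theorem range_incl_normal_ofUnderline : T.incl.range.Normal := by
  refine T.range_incl_normal ?_
  rw [BadPlaceSetting.ofUnderline_range_inclPlain]
  exact hN

include C in
/-- **`[Π^tp_{X̲_v}(P) : incl(P)] = l ≠ 0`** over `BadPlaceSetting.ofUnderline` (abc-iut-L6-t19 `index_range_incl`, abc-iut-L2-t8 `ofUnderline_index_eq`,
abc-iut-L2-t7 `l_ne_zero`).  PROVED. ([IUTchII] Def 2.3 (i), kurims p.67) [claim: Mochizuki2012, status: disputed] -/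
theorem index_range_incl_ne_zero_ofUnderline : T.incl.range.index ≠ 0 := by
  rw [T.index_range_incl, BadPlaceSetting.ofUnderline_index_eq C μ hC hS hl hp2 hpl hζ hη]
  exact C.l_ne_zero

/-- **[IUTchII] Def 2.3 (i) — THE Π-LEVEL `ℍ`-DICTIONARY AT THE GENUINE AGREEMENT (B15: abc-iut-L6-t19's GENUINE `±`-tower `ofPiCHat` ↔ abc-iut-L5's
GENUINE [IUTchI] §2 datum `ofSpecialFibre` of the curve `X̲_v`, abc-iut-L6-t7's `TemperedCurve.ofOpenSubgroup … (GtpXu l) …`; the setting and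
binders of this lineage's p433029 verbatim).**  There are a cuspidal datum `Cu` (abc-iut-w5-d028's transported one) and an agreement `A` with
`eHat ∘ emb = ιX ∘ plainIso`, `eHat` BICONTINUOUS, and — given [IUTchI] Cor 2.3 (iv) for that datum (`Cor23iv` under `Cor23Hyp`, BY NAME) —
**`A.PiSubgraphDictionary H▶`** at the decomposition subgroup `H▶ := incl⁻¹(plainIso⁻¹ Π^tp_{X̲_v,ℍ})` («`Π_{v▶} := Π_v ∩ Π^tp_{X̲_v,ℍ}`»): `eHat`
carries `Π^±_{v▶} := N_{Π^±_v}(Π_{v▶})` onto `Π^tp_{X̲_v,ℍ} ↪ Π̂_{X̲_v}` («[cf. [IUTchI], Corollary 2.3, (iv)]»; `Π_v ⊴ Π^±_v` of index `l` are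
theorems here).  PROVED.  HONEST LABEL: GENUINE on both sides modulo the binders named in the signature (`hZ`, `hN`, `hDopen`, the
special-fibre DATA of `X̲_v`, Cor 2.3 (iv) for it); nothing of the series is asserted; no side taken on [IUTchIII] Cor 3.12.
([IUTchII] Def 2.3 (i)(ii), kurims pp.67–68) [claim: Mochizuki2012, status: disputed] -/
theorem exists_stableCurveAgreement_piSubgraphDictionary_ofPiCHat_ofSpecialFibre [(M.GtpXu l).FiniteIndex]
    [FiniteDimensional ℚ_[p] M.K]
    (hDopen : ∀ (x : M.toTemperedCurve.Pt) (g : M.toTemperedCurve.PiTemp),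
      IsOpen (M.toTemperedCurve.aug '' ((M.toTemperedCurve.decompOfOpenAt (M.GtpXu l) x g).map (M.GtpXu l).subtype :
        Set M.toTemperedCurve.PiTemp)))
    (d : (M.toTemperedCurve.ofOpenSubgroup (M.GtpXu l) (M.toThetaSetting.isOpen_GtpXu l) M.K (range_aug_GtpXu_eq_GK C) hDopen).GroupLevelData)
    (Sf : SpecialFibreData ((M.toTemperedCurve.ofOpenSubgroup (M.GtpXu l) (M.toThetaSetting.isOpen_GtpXu l) M.K (range_aug_GtpXu_eq_GK C) hDopen).toTemperedArithmeticGroup d))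
    (h36 : Sf.Gc.Prop36Hypotheses) (Sigma SigmaHat : Set ℕ) (hsub : Sigma ⊆ SigmaHat) (hne : Sigma.Nonempty)
    (hprime : ∀ q ∈ SigmaHat, q.Prime) (hp : p ∉ Sigma) (TpH : Subgroup Sf.chart.G)
    (HatH : Subgroup (TemperedGraphGroupData.exists_completion_of_prop36 Sf.Gc h36 Sf.chart).choose)
    (hle : TpH.map (TemperedGraphGroupData.exists_completion_of_prop36 Sf.Gc h36 Sf.chart).choose_spec.choose.toMonoidHom ≤ HatH)
    (cuspMeetsH : {x : (M.toTemperedCurve.ofOpenSubgroup (M.GtpXu l) (M.toThetaSetting.isOpen_GtpXu l) M.K (range_aug_GtpXu_eq_GK C) hDopen).Pt // (M.toTemperedCurve.ofOpenSubgroup (M.GtpXu l) (M.toThetaSetting.isOpen_GtpXu l) M.K (range_aug_GtpXu_eq_GK C) hDopen).IsCusp x} → Prop)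
    (hHyp : (StableCurveTemperedData.ofSpecialFibre (M.toTemperedCurve.ofOpenSubgroup (M.GtpXu l) (M.toThetaSetting.isOpen_GtpXu l) M.K (range_aug_GtpXu_eq_GK C) hDopen) d Sf h36 Sigma SigmaHat hsub hne hprime hp TpH HatH hle cuspMeetsH).Cor23Hyp) (h23iv : (StableCurveTemperedData.ofSpecialFibre (M.toTemperedCurve.ofOpenSubgroup (M.GtpXu l) (M.toThetaSetting.isOpen_GtpXu l) M.K (range_aug_GtpXu_eq_GK C) hDopen) d Sf h36 Sigma SigmaHat hsub hne hprime hp TpH HatH hle cuspMeetsH).Cor23iv) :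
    ∃ (Cu : CuspidalInertiaData (ofPiCHat e C μ hC hS hl hp2 hpl hζ hη hZ hN T)) (A : StableCurveAgreement (ofPiCHat e C μ hC hS hl hp2 hpl hζ hη hZ hN T) Cu (StableCurveTemperedData.ofSpecialFibre (M.toTemperedCurve.ofOpenSubgroup (M.GtpXu l) (M.toThetaSetting.isOpen_GtpXu l) M.K (range_aug_GtpXu_eq_GK C) hDopen) d Sf h36 Sigma SigmaHat hsub hne hprime hp TpH HatH hle cuspMeetsH)),
      IsHomeomorph A.eHat ∧
      (∀ x : T.Xplain,
        A.eHat ⟨(ofPiCHat e C μ hC hS hl hp2 hpl hζ hη hZ hN T).emb x, (ofPiCHat e C μ hC hS hl hp2 hpl hζ hη hZ hN T).emb_le_pmHat ⟨x, rfl⟩⟩ = (StableCurveTemperedData.ofSpecialFibre (M.toTemperedCurve.ofOpenSubgroup (M.GtpXu l) (M.toThetaSetting.isOpen_GtpXu l) M.K (range_aug_GtpXu_eq_GK C) hDopen) d Sf h36 Sigma SigmaHat hsub hne hprime hp TpH HatH hle cuspMeetsH).ιX (T.plainIso x)) ∧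
      (∀ (Q I : Subgroup (ofPiCHat e C μ hC hS hl hp2 hpl hζ hη hZ hN T).Corhat), Cu.IsCuspidalInertia Q I ↔
        I ≤ Q ∧ ∃ I₀, Cu.IsCuspidalInertia (ofPiCHat e C μ hC hS hl hp2 hpl hζ hη hZ hN T).piPM I₀ ∧ I = I₀ ⊓ Q) ∧
      A.PiSubgraphDictionary (((StableCurveTemperedData.ofSpecialFibre (M.toTemperedCurve.ofOpenSubgroup (M.GtpXu l) (M.toThetaSetting.isOpen_GtpXu l) M.K (range_aug_GtpXu_eq_GK C) hDopen) d Sf h36 Sigma SigmaHat hsub hne hprime hp TpH HatH hle cuspMeetsH).piTpXH.comap T.plainIso.toMulEquiv.toMonoidHom).comap T.incl) := by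
  -- (a) tower side: `Π̂^±_v` is a profinite completion of `Π^±_v` through `emb` (p431233)
  obtain ⟨embHat, hembHat, hWc⟩ := exists_embHat_ofPiCHat e C μ hC hS hl hp2 hpl hζ hη hZ hN T
  -- (d) `prHat` of the curve side is continuous (`augHat` is)
  have hpr : Continuous (StableCurveTemperedData.OfSpecialFibre.augHatGK (M.toTemperedCurve.ofOpenSubgroup (M.GtpXu l) (M.toThetaSetting.isOpen_GtpXu l) M.K (range_aug_GtpXu_eq_GK C) hDopen)) :=
    (M.toTemperedCurve.ofOpenSubgroup (M.GtpXu l) (M.toThetaSetting.isOpen_GtpXu l) M.K (range_aug_GtpXu_eq_GK C) hDopen).augHat.continuous.subtype_mk _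
  -- (d) `augGK (plainIso x) = aug (emb x)` in `G_K` (σ := id)
  have hcompat : ∀ x : T.Xplain, (StableCurveTemperedData.ofSpecialFibre (M.toTemperedCurve.ofOpenSubgroup (M.GtpXu l) (M.toThetaSetting.isOpen_GtpXu l) M.K (range_aug_GtpXu_eq_GK C) hDopen) d Sf h36 Sigma SigmaHat hsub hne hprime hp TpH HatH hle cuspMeetsH).prTp (T.plainIso x) = (MonoidHom.id _) ((ofPiCHat e C μ hC hS hl hp2 hpl hζ hη hZ hN T).aug ((ofPiCHat e C μ hC hS hl hp2 hpl hζ hη hZ hN T).emb x)) := by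
    intro x
    apply Subtype.ext
    change M.aug (T.plainIso x).1 = ((ofPiCHat e C μ hC hS hl hp2 hpl hζ hη hZ hN T).aug ((ofPiCHat e C μ hC hS hl hp2 hpl hζ hη hZ hN T).emb x)).1
    exact (ofCoverModel_aug_ι_inclX e C μ hC hS hl hp2 hpl hζ hη e.toPiCHat e.isProfiniteCompletion_toPiCHat
      e.toPiCHat_injective e.piCData.aug.toMonoidHom (fun g => e.piCData_aug_apply g) e.piCData.range_aug hZ hN T
      (T.plainIso x).1).symm
  obtain ⟨Cu, A, hhom, hA, hlev, hdic⟩ := StableCurveAgreement.exists_piSubgraphDictionary_of_isProfiniteCompletion (ofPiCHat e C μ hC hS hl hp2 hpl hζ hη hZ hN T) (StableCurveTemperedData.ofSpecialFibre (M.toTemperedCurve.ofOpenSubgroup (M.GtpXu l) (M.toThetaSetting.isOpen_GtpXu l) M.K (range_aug_GtpXu_eq_GK C) hDopen) d Sf h36 Sigma SigmaHat hsub hne hprime hp TpH HatH hle cuspMeetsH)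
    embHat hembHat hWc (M.toTemperedCurve.ofOpenSubgroup (M.GtpXu l) (M.toThetaSetting.isOpen_GtpXu l) M.K (range_aug_GtpXu_eq_GK C) hDopen).toHat (fun _ => rfl) (M.toTemperedCurve.ofOpenSubgroup (M.GtpXu l) (M.toThetaSetting.isOpen_GtpXu l) M.K (range_aug_GtpXu_eq_GK C) hDopen).isProfiniteCompletion_toHat T.plainIso
    (continuous_aug_pmHat_ofPiCHat e C μ hC hS hl hp2 hpl hζ hη hZ hN T) hpr (MonoidHom.id _) continuous_id
    Function.injective_id hcompat (range_incl_normal_ofUnderline C μ hC hS hl hp2 hpl hζ hη hN T)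
    (index_range_incl_ne_zero_ofUnderline C μ hC hS hl hp2 hpl hζ hη T) hHyp h23iv
  refine ⟨Cu, A, hhom, fun x => ?_, hlev, hdic⟩
  have h2 : embHat x = ⟨(ofPiCHat e C μ hC hS hl hp2 hpl hζ hη hZ hN T).emb x, (ofPiCHat e C μ hC hS hl hp2 hpl hζ hη hZ hN T).emb_le_pmHat ⟨x, rfl⟩⟩ := Subtype.ext (hembHat x)
  have h1 := hA x
  rw [h2] at h1
  exact h1

end Genuine

end PlusMinusTower

end Literature.IUT.HodgeArakelov

end
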